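import Mathlib

/-!
# No unital-type (two-intersection) sets in affine planes of prime order

Wall-breaker axis "Hermitian unital constructions" (k7/12) for the stub `stub_tangencySets` of the crux
`LevelOneGL2Designs` (stmt-MatrixMultiplication-14080, route LevelGradedCohnUmans).

The stub asks for tangency sets (strong representative systems) of size `c·p^{3/2}` in `AG(2,p)`, `p`
PRIME.  The only known configurations at that scale in any finite plane are the unitals of square-order
planes, and what makes a unital work is its REGULARITY: every line meets it in `1` or `n = √q + 1` points
(a set of type `(1,n)`), so every point has (exactly) one tangent.  This file proves that this mechanism
has no prime-order instance whatsoever: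

* `dvd_of_type_one_n` — if `K ⊆ 𝔽_p²` is met by every affine line in `1` or `n` points (`2 ≤ n`), and
  `K` is neither empty nor the whole plane, then `n − 1 ∣ p`.  (Pencil count through a point of `K`:
  `|K| ≡ 1 (mod n−1)`; through a point off `K`: `|K| ≡ p+1 (mod n−1)`.)
* `type_one_n_prime` — hence for `p` prime `n = 2` (or the degenerate `n = p+1`, impossible in the
  affine plane), and then `|K| ≤ p + 2`: two-intersection sets in `AG(2,p)` have LINEAR size.

So a prime-order tangency set at the stub's scale must have at least three line-intersection numbers —
the unital's defining regularity (equivalently, by Illés–Szőnyi–Wettl, equality in `|SRS| ≤ q√q+1`)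
is unavailable, independently of the absence of a field involution on `ZMod p`.  The pencil of lines
through a point `R` is parametrised by the `p+1` normal vectors `(1,t)`, `t ∈ 𝔽_p`, and `(0,1)`, each
`v ≠ R` lying on exactly one of these lines (`card_reps_orthogonal`, `pencil_sum`).

Elementary counting (Tallini Scafati-type divisibility for sets of class `[1,n]`); Mathlib only; no new
definitions.
-/

-- `Summit.MatrixMultiplication.MatrixMultiplication.…` is the tree's mandated summit/problem namespace (D-0017).
set_option linter.dupNamespace false

namespace Summit.MatrixMultiplication.MatrixMultiplication.Theorems.LevelOneGL2Designs.UnitalType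

open Finset

variable {p : ℕ} [hp : Fact p.Prime]

/-- Dot product with the normal vector `(1,t)`: `(1,t) ⬝ w = w 0 + t·w 1`. [elementary] -/
theorem dotProduct_oneT (t : ZMod p) (w : Fin 2 → ZMod p) :
    dotProduct ![1, t] w = w 0 + t * w 1 := by
  simp [dotProduct, Fin.sum_univ_two]

/-- Dot product with the normal vector `(0,1)`: `(0,1) ⬝ w = w 1`. [elementary] -/
theorem dotProduct_zeroOne (w : Fin 2 → ZMod p) : dotProduct ![0, 1] w = w 1 := by
  simp [dotProduct, Fin.sum_univ_two]

/-- **The pencil through a point, counted by normal vectors.**  For `w ≠ 0` in `𝔽_p²` there is exactly one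
normal vector among `(1,t)` (`t ∈ 𝔽_p`) and `(0,1)` orthogonal to `w`; we phrase it as: the number of
`t` with `(1,t) ⬝ w = 0` plus `[ (0,1) ⬝ w = 0 ]` equals `1`. [elementary] -/
theorem card_reps_orthogonal {w : Fin 2 → ZMod p} (hw : w ≠ 0) :
    (univ.filter fun t : ZMod p => dotProduct ![1, t] w = 0).card +
      (if dotProduct ![0, 1] w = 0 then 1 else 0) = 1 := by
  simp only [dotProduct_oneT, dotProduct_zeroOne]
  by_cases h1 : w 1 = 0
  · -- then `w 0 ≠ 0`, no `t` works, `(0,1)` works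
    have h0 : w 0 ≠ 0 := by
      intro h0
      apply hw
      funext i
      fin_cases i
      · exact h0
      · exact h1
    rw [if_pos h1]
    have : (univ.filter fun t : ZMod p => w 0 + t * w 1 = 0) = ∅ := by
      apply Finset.filter_false_of_mem
      intro t _
      rw [h1, mul_zero, add_zero]
      exact h0
    rw [this, Finset.card_empty]
  · rw [if_neg h1, add_zero]
    have : (univ.filter fun t : ZMod p => w 0 + t * w 1 = 0) = {-(w 0) / w 1} := by
      ext t
      simp only [Finset.mem_filter, Finset.mem_univ, true_and, Finset.mem_singleton]
      constructor
      · intro h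
        field_simp
        linear_combination h
      · rintro rfl
        field_simp
        ring
    rw [this, Finset.card_singleton]

/-- **Pencil count.**  For any finite `K ⊆ 𝔽_p²` and any point `R`, summing over the `p+1` lines through `R`
(normal vectors `(1,t)` and `(0,1)`) the number of points of `K ∖ {R}` on each line gives `|K ∖ {R}|`:
`∑_t #{v ∈ K, v ≠ R, (1,t)⬝(v−R)=0} + #{v ∈ K, v ≠ R, (0,1)⬝(v−R)=0} = #(K.erase R)`. [elementary] -/
theorem pencil_sum (K : Finset (Fin 2 → ZMod p)) (R : Fin 2 → ZMod p) :
    (∑ t : ZMod p, ((K.erase R).filter fun v => dotProduct ![1, t] (v - R) = 0).card) +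
      ((K.erase R).filter fun v => dotProduct ![0, 1] (v - R) = 0).card = (K.erase R).card := by
  classical
  -- rewrite each filtered cardinality as a sum of indicators over `K.erase R`, then swap sums
  have h1 : ∀ t : ZMod p, ((K.erase R).filter fun v => dotProduct ![1, t] (v - R) = 0).card =
      ∑ v ∈ K.erase R, if dotProduct ![1, t] (v - R) = 0 then 1 else 0 := by
    intro t
    rw [Finset.card_eq_sum_ones, Finset.sum_filter]
  have h2 : ((K.erase R).filter fun v => dotProduct ![0, 1] (v - R) = 0).card =
      ∑ v ∈ K.erase R, if dotProduct ![0, 1] (v - R) = 0 then 1 else 0 := by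
    rw [Finset.card_eq_sum_ones, Finset.sum_filter]
  simp_rw [h1, h2]
  rw [Finset.sum_comm, ← Finset.sum_add_distrib, Finset.card_eq_sum_ones]
  refine Finset.sum_congr rfl fun v hv => ?_
  have hw : v - R ≠ 0 := sub_ne_zero.2 (Finset.ne_of_mem_erase hv)
  have := card_reps_orthogonal (p := p) hw
  rw [Finset.card_eq_sum_ones, Finset.sum_filter] at this
  exact this

/-- **Divisibility for sets of type `(1,n)` (Tallini Scafati-type count).**  Let `K ⊆ 𝔽_p²` be met by every
affine line `{v : a ⬝ v = c}` (`a ≠ 0`) in either `1` or `n` points, `2 ≤ n`, with a point `P ∈ K` and a point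
`Q ∉ K`.  Then `n − 1 ∣ p`.  Proof: the `p+1` lines through `P` partition `K ∖ {P}` into parts of size
`0` or `n−1`, so `n−1 ∣ |K|−1`; the `p+1` lines through `Q` partition `K` into parts of size `1` or `n`, so
`n−1 ∣ |K|−(p+1)`; subtract. [elementary; cf. sets of class `[1,n]`, Tallini Scafati 1966] -/
theorem dvd_of_type_one_n (K : Finset (Fin 2 → ZMod p)) (n : ℕ) (hn : 2 ≤ n)
    (htype : ∀ a : Fin 2 → ZMod p, a ≠ 0 → ∀ c : ZMod p,
      (K.filter fun v => dotProduct a v = c).card = 1 ∨ (K.filter fun v => dotProduct a v = c).card = n)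
    {P Q : Fin 2 → ZMod p} (hP : P ∈ K) (hQ : Q ∉ K) : n - 1 ∣ p := by
  classical
  obtain ⟨d, rfl⟩ : ∃ d, n = d + 1 := ⟨n - 1, by omega⟩
  rw [Nat.add_sub_cancel]
  have hone : ∀ t : ZMod p, (![1, t] : Fin 2 → ZMod p) ≠ 0 := by
    intro t h; have := congrFun h 0; simp at this
  have hzo : (![0, 1] : Fin 2 → ZMod p) ≠ 0 := by
    intro h; have := congrFun h 1; simp at this
  -- a line through `R` with normal `a`, restricted to `K.erase R`
  have key : ∀ (R a : Fin 2 → ZMod p), a ≠ 0 →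
      ((K.erase R).filter fun v => dotProduct a (v - R) = 0).card + (if R ∈ K then 1 else 0) =
        (K.filter fun v => dotProduct a v = dotProduct a R).card := by
    intro R a ha
    have hset : (K.filter fun v => dotProduct a v = dotProduct a R) =
        ((K.erase R).filter fun v => dotProduct a (v - R) = 0) ∪ (if R ∈ K then {R} else ∅) := by
      ext v
      simp only [Finset.mem_filter, Finset.mem_union, Finset.mem_erase, ne_eq, dotProduct_sub,
        sub_eq_zero]
      constructor
      · rintro ⟨hvK, hv⟩
        by_cases hvR : v = R
        · subst hvR
          right
          rw [if_pos hvK]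
          exact Finset.mem_singleton_self _
        · exact Or.inl ⟨⟨hvR, hvK⟩, hv⟩
      · rintro (⟨⟨-, hvK⟩, hv⟩ | hv)
        · exact ⟨hvK, hv⟩
        · split_ifs at hv with hRK
          · rw [Finset.mem_singleton] at hv
            subst hv
            exact ⟨hRK, rfl⟩
          · exact absurd hv (Finset.notMem_empty v)
    rw [hset, Finset.card_union_of_disjoint]
    · congr 1
      split_ifs <;> simp
    · split_ifs
      · rw [Finset.disjoint_singleton_right]
        intro h
        exact (Finset.mem_erase.1 (Finset.mem_filter.1 h).1).1 rfl
      · exact disjoint_empty_right _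
  -- every such restricted line has size ≡ [R ∉ K] (mod d), d = n - 1
  have hd1 : (((d + 1 : ℕ) : ℕ) : ZMod d) = 1 := by
    push_cast
    rw [ZMod.natCast_self, zero_add]
  have hmod : ∀ (R a : Fin 2 → ZMod p), a ≠ 0 →
      (((K.erase R).filter fun v => dotProduct a (v - R) = 0).card : ZMod d) =
        (if R ∈ K then 0 else 1) := by
    intro R a ha
    have hk := key R a ha
    rcases htype a ha (dotProduct a R) with h | h <;> rw [h] at hk <;> split_ifs at hk ⊢ with hRK
    · have : ((K.erase R).filter fun v => dotProduct a (v - R) = 0).card = 0 := by omega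
      rw [this, Nat.cast_zero]
    · have : ((K.erase R).filter fun v => dotProduct a (v - R) = 0).card = 1 := by omega
      rw [this, Nat.cast_one]
    · have : ((K.erase R).filter fun v => dotProduct a (v - R) = 0).card = d := by omega
      rw [this, ZMod.natCast_self]
    · have : ((K.erase R).filter fun v => dotProduct a (v - R) = 0).card = d + 1 := by omega
      rw [this, hd1]
  -- pencil sums, cast into `ZMod d`
  have hsumP := congrArg (fun m : ℕ => (m : ZMod d)) (pencil_sum K P)
  have hsumQ := congrArg (fun m : ℕ => (m : ZMod d)) (pencil_sum K Q)
  simp only [Nat.cast_add, Nat.cast_sum] at hsumP hsumQ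
  simp_rw [hmod P _ (hone _), hmod P _ hzo, hmod Q _ (hone _), hmod Q _ hzo, if_pos hP, if_neg hQ]
    at hsumP hsumQ
  rw [Finset.erase_eq_of_notMem hQ] at hsumQ
  rw [Finset.card_erase_of_mem hP] at hsumP
  simp only [Finset.sum_const, Finset.card_univ, ZMod.card, smul_zero, add_zero, nsmul_eq_mul,
    mul_one] at hsumP hsumQ
  -- hsumP : 0 = ↑(K.card - 1) ;  hsumQ : ↑p + 1 = ↑K.card
  have hK1 : 1 ≤ K.card := Finset.card_pos.2 ⟨P, hP⟩
  have hcast : ((K.card - 1 : ℕ) : ZMod d) = (K.card : ZMod d) - 1 := by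
    rw [Nat.cast_sub hK1, Nat.cast_one]
  rw [hcast, ← hsumQ] at hsumP
  -- 0 = p + 1 - 1 = p in ZMod d
  have hp0 : ((p : ℕ) : ZMod d) = 0 := by
    rw [hsumP]; ring
  exact (ZMod.natCast_eq_zero_iff p d).1 hp0

/-- **No unital-type sets in `AG(2,p)`, `p` prime.**  Under the hypotheses of `dvd_of_type_one_n` with `p`
prime: `n = 2`, and then `|K| ≤ p + 2` (through `P ∈ K` the `p+1` lines carry at most one further point
each).  In particular a set of type `(1, n)` with `n ≥ 3` — the combinatorial type of a unital
(`n = √q+1`) or a Baer subplane — does not exist in an affine plane of prime order, so every prime-order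
tangency set at the scale `p^{3/2}` has at least three line-intersection numbers. [elementary] -/
theorem type_one_n_prime (K : Finset (Fin 2 → ZMod p)) (n : ℕ) (hn : 2 ≤ n)
    (htype : ∀ a : Fin 2 → ZMod p, a ≠ 0 → ∀ c : ZMod p,
      (K.filter fun v => dotProduct a v = c).card = 1 ∨ (K.filter fun v => dotProduct a v = c).card = n)
    {P Q : Fin 2 → ZMod p} (hP : P ∈ K) (hQ : Q ∉ K) : n = 2 ∧ K.card ≤ p + 2 := by
  classical
  have hdvd := dvd_of_type_one_n K n hn htype hP hQ
  have hprime := hp.out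
  -- n - 1 ∣ p, p prime ⇒ n - 1 = 1 ∨ n - 1 = p
  rcases (Nat.dvd_prime hprime).1 hdvd with h1 | h2
  · have hn2 : n = 2 := by omega
    refine ⟨hn2, ?_⟩
    -- count through P: pencil_sum with parts of size ≤ 1 (= card - 1 ∈ {0, n-1} = {0,1})
    have hone : ∀ t : ZMod p, (![1, t] : Fin 2 → ZMod p) ≠ 0 := by
      intro t h; have := congrFun h 0; simp at this
    have hzo : (![0, 1] : Fin 2 → ZMod p) ≠ 0 := by
      intro h; have := congrFun h 1; simp at this
    have hle : ∀ a : Fin 2 → ZMod p, a ≠ 0 →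
        ((K.erase P).filter fun v => dotProduct a (v - P) = 0).card ≤ 1 := by
      intro a ha
      have hsub : ((K.erase P).filter fun v => dotProduct a (v - P) = 0) ⊆
          (K.filter fun v => dotProduct a v = dotProduct a P).erase P := by
        intro v hv
        simp only [Finset.mem_filter, Finset.mem_erase, ne_eq, dotProduct_sub, sub_eq_zero] at hv ⊢
        exact ⟨hv.1.1, hv.1.2, hv.2⟩
      have hcard := Finset.card_le_card hsub
      have hmem : P ∈ K.filter (fun v => dotProduct a v = dotProduct a P) :=
        Finset.mem_filter.2 ⟨hP, rfl⟩
      rw [Finset.card_erase_of_mem hmem] at hcard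
      rcases htype a ha (dotProduct a P) with h | h <;> rw [h] at hcard <;> omega
    have hsum := pencil_sum K P
    rw [Finset.card_erase_of_mem hP] at hsum
    have hbound : (∑ t : ZMod p, ((K.erase P).filter fun v => dotProduct ![1, t] (v - P) = 0).card) +
        ((K.erase P).filter fun v => dotProduct ![0, 1] (v - P) = 0).card ≤ p * 1 + 1 := by
      apply add_le_add
      · calc (∑ t : ZMod p, ((K.erase P).filter fun v => dotProduct ![1, t] (v - P) = 0).card)
            ≤ ∑ _t : ZMod p, 1 := Finset.sum_le_sum fun t _ => hle _ (hone t)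
          _ = p * 1 := by rw [Finset.sum_const, Finset.card_univ, ZMod.card, smul_eq_mul]
      · exact hle _ hzo
    have hK1 : 1 ≤ K.card := Finset.card_pos.2 ⟨P, hP⟩
    omega
  · -- n - 1 = p: then a line through Q meets K in 1 or p+1 > p points; the latter is impossible, so all
    -- p+1 lines through Q are tangent-like and |K| = p+1; but through P, |K|-1 = p is a sum of 0's and p's
    -- over p+1 lines, so exactly one line through P carries p further points: that line has p+1 > p points.
    exfalso
    have hn' : n = p + 1 := by omega
    -- a line has only p points
    have hline : ∀ a : Fin 2 → ZMod p, a ≠ 0 → ∀ c : ZMod p,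
        (K.filter fun v => dotProduct a v = c).card ≤ p := by
      intro a ha c
      -- the line {v : a ⬝ v = c} has at most p points: it injects into 𝔽_p via a coordinate
      have ha' : a 0 ≠ 0 ∨ a 1 ≠ 0 := by
        by_contra h
        push Not at h
        apply ha; funext i; fin_cases i
        · exact h.1
        · exact h.2
      rcases ha' with h0 | h1
      · -- project to the second coordinate
        have hinj : Set.InjOn (fun v : Fin 2 → ZMod p => v 1)
            ↑(K.filter fun v => dotProduct a v = c) := by
          intro v hv w hw hvw
          simp only [Finset.coe_filter, Set.mem_setOf_eq, dotProduct, Fin.sum_univ_two] at hv hw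
          simp only at hvw
          funext i; fin_cases i
          · simp only [Fin.zero_eta]
            have : a 0 * v 0 = a 0 * w 0 := by linear_combination hv.2 - hw.2 - a 1 * hvw
            exact mul_left_cancel₀ h0 this
          · exact hvw
        calc (K.filter fun v => dotProduct a v = c).card
            = ((K.filter fun v => dotProduct a v = c).image fun v => v 1).card :=
              (Finset.card_image_of_injOn hinj).symm
          _ ≤ (univ : Finset (ZMod p)).card := Finset.card_le_card (Finset.subset_univ _)
          _ = p := by rw [Finset.card_univ, ZMod.card]
      · have hinj : Set.InjOn (fun v : Fin 2 → ZMod p => v 0)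
            ↑(K.filter fun v => dotProduct a v = c) := by
          intro v hv w hw hvw
          simp only [Finset.coe_filter, Set.mem_setOf_eq, dotProduct, Fin.sum_univ_two] at hv hw
          simp only at hvw
          funext i; fin_cases i
          · exact hvw
          · simp only [Fin.mk_one]
            have : a 1 * v 1 = a 1 * w 1 := by linear_combination hv.2 - hw.2 - a 0 * hvw
            exact mul_left_cancel₀ h1 this
        calc (K.filter fun v => dotProduct a v = c).card
            = ((K.filter fun v => dotProduct a v = c).image fun v => v 0).card :=
              (Finset.card_image_of_injOn hinj).symm
          _ ≤ (univ : Finset (ZMod p)).card := Finset.card_le_card (Finset.subset_univ _)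
          _ = p := by rw [Finset.card_univ, ZMod.card]
    -- hence every line meets K in exactly one point
    have hall : ∀ a : Fin 2 → ZMod p, a ≠ 0 → ∀ c : ZMod p,
        (K.filter fun v => dotProduct a v = c).card = 1 := by
      intro a ha c
      rcases htype a ha c with h | h
      · exact h
      · have := hline a ha c; rw [h, hn'] at this; omega
    -- but P ∈ K and |K| ≥ 2?  Through Q: |K| = p + 1 ≥ 3, so K has two points P ≠ P', and the line
    -- through them (normal vector orthogonal to P' - P) meets K in ≥ 2 points.
    have hsumQ := pencil_sum K Q
    rw [Finset.erase_eq_of_notMem hQ] at hsumQ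
    have hzo : (![0, 1] : Fin 2 → ZMod p) ≠ 0 := by
      intro h; have := congrFun h 1; simp at this
    have hone : ∀ t : ZMod p, (![1, t] : Fin 2 → ZMod p) ≠ 0 := by
      intro t h; have := congrFun h 0; simp at this
    -- each restricted line through Q has exactly 1 point of K
    have hQ1 : ∀ a : Fin 2 → ZMod p, a ≠ 0 →
        ((K.erase Q).filter fun v => dotProduct a (v - Q) = 0).card = 1 := by
      intro a ha
      rw [Finset.erase_eq_of_notMem hQ]
      have : (K.filter fun v => dotProduct a (v - Q) = 0) = K.filter fun v => dotProduct a v = dotProduct a Q := by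
        congr 1; ext v; rw [dotProduct_sub, sub_eq_zero]
      rw [this]
      exact hall a ha _
    rw [Finset.erase_eq_of_notMem hQ] at hQ1
    simp_rw [hQ1 _ (hone _), hQ1 _ hzo, Finset.sum_const, Finset.card_univ, ZMod.card,
      smul_eq_mul, mul_one] at hsumQ
    -- hsumQ : p + 1 = K.card; pick P₁ ∈ K, P₁ ≠ P
    have hK2 : 1 < K.card := by have := hprime.two_le; omega
    obtain ⟨P₁, hP₁, hne⟩ := Finset.exists_mem_ne hK2 P
    -- normal vector to P' - P
    set w := P₁ - P with hw_def
    have hw : w ≠ 0 := sub_ne_zero.2 hne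
    let a : Fin 2 → ZMod p := ![w 1, -(w 0)]
    have ha : a ≠ 0 := by
      intro h
      have h0 := congrFun h 0
      have h1 := congrFun h 1
      simp only [a, Matrix.cons_val_zero, Matrix.cons_val_one, Pi.zero_apply, neg_eq_zero] at h0 h1
      apply hw; funext i; fin_cases i
      · exact h1
      · exact h0
    have haw : dotProduct a w = 0 := by
      simp [a, dotProduct, Fin.sum_univ_two]; ring
    have h2 : 2 ≤ (K.filter fun v => dotProduct a v = dotProduct a P).card := by
      have hsub : ({P, P₁} : Finset (Fin 2 → ZMod p)) ⊆ K.filter fun v => dotProduct a v = dotProduct a P := by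
        intro v hv
        rw [Finset.mem_insert, Finset.mem_singleton] at hv
        rw [Finset.mem_filter]
        rcases hv with rfl | h
        · exact ⟨hP, rfl⟩
        · rw [h]
          refine ⟨hP₁, ?_⟩
          have : P₁ = P + w := by rw [hw_def]; abel
          rw [this, dotProduct_add, haw, add_zero]
      have := Finset.card_le_card hsub
      rwa [Finset.card_pair hne.symm] at this
    have := hall a ha (dotProduct a P)
    omega

end Summit.MatrixMultiplication.MatrixMultiplication.Theorems.LevelOneGL2Designs.UnitalType
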